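import Literature.MathematicalPhysics.QuantumFieldTheory.Balaban1983to89.B9ThmDCubePlateau
import Literature.MathematicalPhysics.QuantumFieldTheory.Balaban1983to89.B9ThmDLocDiffAlgebra
import Literature.MathematicalPhysics.QuantumFieldTheory.Balaban1983to89.B9Eq352GradLetters

/-!
# `Balaban1983to89.B9Eq3105FamThreeLocDiffG` — FAMILY 3 OF (3.105): THE ONE-SIDED LOCATED `G′`-DIFFERENCE, FILE F3-E1 (identities) — the located
# difference `M_χl·(G′(U₁^u) − G′_□(Ṽ_□))` with GLOBAL columns (resp. `(G′ − G′_□)·M_χl` with global rows) is EXACTLY a gap piece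
# `M_χl·G′·(1 − M_{χ_□})` plus a commutator piece `M_χl·G′·K(χ_□)(Ṽ_□)·G′_□(Ṽ_□)` (resp. `(1 − M_{χ_□})·G′·M_χl + G′_□·(−K(χ_□))·G′·M_χl`), and the
# derivative letter passes a site cut-off at the price of a difference-quotient multiplier — the algebra behind a later in-tree supplier of F3-B's
# displayed located entries `hDL`∕`hDR` (sub-row G-B9-LETTERS, GAPS G-B9-05∕family 3, programme FAMTHREE FILE F3-E1; design `lit-balaban-p33/g103/F3E-SCOPE.md`)

statement-level skeleton of published theorems with citation tags; proofs where landed; nothing here is a claim about the Yang–Mills mass gap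

THE PRINTED LOCUS (verbatim, held `paper:balaban1985-cmp99-background-propagators`, journal page = PDF page + 388).  p. 415 l.29–31: «Next we replace the
operators G′_{□₀} and C_{□₀} by G′_□, C_□, terms with the differences G′_{□₀} − G′_□ and C_{□₀} − C_□ are small by the same reason as before.»; p. 412
l.22–36: «We have proved in [2] that if we have a difference of propagators defined on two domains, then in an estimate of this difference we have, besides
the usual factors …, an exponential factor with a distance between localizations and a closest point where a change was made», «the operators may differ
outside □̃₀»; (3.88)–(3.89) p. 409 (the commutator letter `K(h)`); (3.100) p. 413 «(D_μ hA_ν)(x) = h(x)(D_μA_ν)(x) + (∂_μh)(x)R(U(x, x+ηe_μ))A_ν(x+ηe_μ)»;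
Cor. 3.6 p. 408 («U′ = U^u = e^{iηA}»); [2] = `Balaban1983RegularityDecay`, Sect. 5 Theorem (5.8) p. 594 (statement type; the derivation below is ours).

OURS, NOT PRINT's.  Print proves the smallness of `G′_{□₀} − G′_□` by [2]'s generalized random-walk expansion and the cancellation of common walks;
the tree's (R)-design has no walk expansion for the letters, so — exactly as p21's Theorem-D files D1–D6 do for the letter `X = Q′G′²Q′*` — the located
difference is rewritten by the resolvent-type identity `B9ThmDLocDiffAlgebra.sub_eq_comm_form` from two one-sided inverse laws and the agreement of the
two operators on the rows reached by the plateau cut-off `χ_□` (p21 D2's row laws at the (3.35) datum).  Family 3 needs the ONE-SIDED version (one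
located end, the other end global), which this file records; the estimates (gap kernels, the cube-side kernel of `K(χ_□)G′_□` and its source-global
transfer, the entry-1 dressing) are files F3-E2∕E3.

WHAT THIS FILE CERTIFIES (kernel-checked; 0 `def`, 0 `def … : Prop`, 0 sorry; standard axioms only)

* §1 (any ring) `sub_eq_comm_form'` (the mirrored three-term identity from a LEFT inverse of `O` and a RIGHT inverse of `Ō`), ★ `cut_sub_eq_oneSided`
  (`C·(1 − P) = 0 ⟹ C(O − Ō) = C·O·(1 − P) + C·O·[P, Δ₂]·Ō`), ★ `sub_cut_eq_oneSided` (`(1 − P)·C = 0 ⟹ (O − Ō)C = (1 − P)·O·C + Ō·[Δ₂, P]·O·C`).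
* §2 (def-Y's site carrier, (3.100) for the difference letters of the (3.49) entries) ★ `diffLetter_inl_mul_cutMulY`
  (`∇_μ ∘ M_χ = M_{χ(·+e_μ)} ∘ ∇_μ + c·M_{χ(·+e_μ) − χ}`), ★ `cutMulY_mul_diffLetter_inr` (`M_χ ∘ (−∇*_ν) = (−∇*_ν) ∘ M_{χ(·+e_ν)} + c·M_{χ − χ(·+e_ν)}`).
* §3 (the record's letters at the (3.35) datum, `parS := parSymY i`, `W = U^u`, `Ṽ_□ = locCfgY i □ η A`, plateau `χ_□ = chiY i □`) `cutMulY_chiY_mul_deltaPrimeAY_gauge`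
  (the ROW form of p21 D2's law: `M_{χ_□}Δ′_a(U^u) = M_{χ_□}Δ′_{a,□}(Ṽ_□)`), ★★ `cutMulY_GpY_sub_GpCubeY_eq` (`M_χl(G′(U^u) − G′_□(Ṽ_□)) = M_χlG′(U^u)(1 − M_{χ_□}) +
  M_χlG′(U^u)K(χ_□)(Ṽ_□)G′_□(Ṽ_□)` for any `χl` with `χl·χ_□ = χl`), ★★ `GpY_sub_GpCubeY_cutMulY_eq` (the mirrored one: `(G′(U^u) − G′_□(Ṽ_□))M_χl =
  (1 − M_{χ_□})G′(U^u)M_χl − G′_□(Ṽ_□)K(χ_□)(Ṽ_□)G′(U^u)M_χl`).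
* §4 (the consumer's pair `(U₁, Ṽ_□^{u⁻¹})`, where F3-B∕F3-P read `Gp (cfg U₁) − GpCubeY □ parSymY V′_□`): `deltaPrimeACubeY_gauge_inv_eq` ((3.31)–(3.32) for the cube
  operator), the column and row laws `deltaPrimeAY_mul_cutMulY_chiY_at` ∕ `cutMulY_chiY_mul_deltaPrimeAY_at` transported by `R(u)`, and the two identities there:
  ★★ `cutMulY_GpY_sub_GpCubeY_eq_at`, ★★ `GpY_sub_GpCubeY_cutMulY_eq_at` (inputs `IsUnit Δ′_a(U₁)`, `IsUnit Δ′_{a,□}(Ṽ_□^{u⁻¹})`, the datum).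

HONEST SCOPE ∕ NOT CLAIMED.  Identities only: no inequality of [B9] or [2] is proved here; `hDL`∕`hDR` stay displayed in F3-B∕F3-P until F3-E2∕E3 turn these
identities into majorants (gap piece by p38's `rowSep_majorant_blk`, commutator piece by p21 D3's cube-side kernel + p21's `hasMajorant_conj_site_sandwich_src_global`
∕ p38's `hasMajorant_conj_site_sandwich_decay`, entry-1 dressing by §2 + the (3.42) entries of `G′`).  Hypotheses displayed: `IsUnit Δ′_a(U^u)`, `IsUnit
Δ′_{a,□}(Ṽ_□)`, the datum's `hQ`∕`hgA`.  Count-neutral; NOT a node discharge; no summit ∕ sub-problem statement is proved; nothing continuum ∕ OS ∕ mass-gap ∕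
Clay; YM mass gap NOT proved (Track A conditional rung).  No `sorry`, no `axiom`, no `… : Prop` fact, no `instance`, no `notation`, no `def`.  NEW file; nothing
landed is modified.  Cell `lit-balaban`, seat `lit-balaban-p33` gen 103, 2026-08-29; `--supports stmt-QuantumFields-19200` as helper.  Net new unproved facts: 0.

RELATED IN THE TREE, NOT DUPLICATED (searched 2026-08-29: `rg 'oneSided|diffLetter_inl_mul_cutMulY|cutMulY_chiY_mul_deltaPrimeAY' Literature/` = ∅): p21 D1
`B9ThmDLocDiffAlgebra` (`sub_eq_comm_form`, the two-sided instance `cutMulY_GpY_sq_sub_locLetterY_sq_cutMulY` for `G′² − O_□²`), D2 `B9ThmDCubePlateau` (row laws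
`deltaPrimeAY_gauge_mul_cutMulY_chiY`, `comm_cutMulY_chiY_deltaPrimeACubeY`), `B9Eq3104CutoffCommutators.cutCommR_gradY` ((3.100) for `D_U : sites → bonds`; §2 is
its site-carrier twin for the (3.49) difference letters `diffLetter`) — all USED BY NAME.
-/

noncomputable section

namespace Literature.MathematicalPhysics.QuantumFieldTheory.Balaban1983to89.B9Eq3105FamThreeLocDiffG

open B6KLevelCensusIndexV1 (KIdx)
open B6Cover236MultiLevelBlocks (cubes)
open B6GlobalChartV1 (PV boxEquiv)
open B9Eq39Adjoint (R R_smul fluct)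
open B9Eq352GradLetters (diffLetter diffLetter_inl diffLetter_inr)
open B9Eq352DivFormLetters (gradLetterF_apply gradLetterB_apply)
open B9Eq360DeltaPrimeAY (AfldY)
open B9Thm37CubeCoverCommutators (cutMulY cutMulY_apply cutMulY_mul KhY stencilY self_mem_stencilY)
open B9ThmDLocDiffAlgebra (sub_eq_comm_form)
open B9ThmDCubePlateau (Dchi mem_Dchi nearH_of_mem_Dchi nearC_of_mem_Dchi agreeNearY_locCfgY_of_nearC' deltaPrimeAY_gauge_mul_cutMulY_chiY
  comm_cutMulY_chiY_deltaPrimeACubeY)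
open B9Cor36CubeCutoffs (SC chiY locCfgY NearC nine_le_SC)
open B9Cor36CubeTwinsGeometry (bS eight_mul_bS_le_SC)
open B9Cor36GpCubeLocLetter (deltaPrimeAY_eq_conj conjY_inv_mul_conjY conjY_mul_conjY_inv cutMulY_mul_conjY)
open B9CubeLettersCovarianceL0 (deltaPrimeACubeY_cov)
open B9CubeLettersOpsL0 (GpCubeY deltaPrimeACubeY deltaPrimeACubeY_mul_GpCubeY GpCubeY_mul_deltaPrimeACubeY deltaPrimeACubeY_apply_eq_of_nearH)
open Node00
open Node00.OpsYLocalInverseAgree (parLocalY_parSymY deltaPrimeAY_apply_congr_of_parLocalY)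

variable {d ℓ : ℕ} {hd : 1 ≤ d + 1} {hL : Odd (ℓ + 1) ∧ 1 < ℓ + 1} {b₀ b₁ : ℝ}
variable {𝔸 : Type} [NormedRing 𝔸] [NormedAlgebra ℂ 𝔸] [CompleteSpace 𝔸]

/-! ## §1  The one-sided identities (any ring) -/

section Ring

variable {𝓡 : Type*} [Ring 𝓡]

/-- ★ **`O − Ō = (1 − P)O − Ō(1 − P) + Ō·[Δ₂, P]·O`** from `Δ₁O = 1`, `ŌΔ₂ = 1`, `PΔ₁ = PΔ₂` — the mirror image of p21's `sub_eq_comm_form` (a LEFT inverse of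
`O`, a RIGHT inverse of `Ō`, the operators agreeing on the rows CUT by `P`).
[cite: Balaban1985BackgroundPropagators, (3.97) p.412 («the operators may differ outside □̃₀»), (3.88) p.409; Balaban1983RegularityDecay, Sect. 5 Thm (5.8) p.594 (statement type; derivation ours)] -/
theorem sub_eq_comm_form' {O Ob Δ₁ Δ₂ P : 𝓡} (h1 : Δ₁ * O = 1) (h2 : Ob * Δ₂ = 1) (hP : P * Δ₁ = P * Δ₂) :
    O - Ob = (1 - P) * O - Ob * (1 - P) + Ob * (Δ₂ * P - P * Δ₂) * O := by
  have e1 : Ob * (Δ₂ * P - P * Δ₂) * O = P * O - Ob * P := by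
    rw [mul_sub, sub_mul]
    congr 1
    · rw [← mul_assoc Ob Δ₂ P, h2, one_mul]
    · rw [← hP, mul_assoc Ob (P * Δ₁) O, mul_assoc P Δ₁ O, h1, mul_one]
  rw [e1]; noncomm_ring

/-- ★ **THE LEFT-LOCATED DIFFERENCE WITH GLOBAL COLUMNS**: if `C·(1 − P) = 0` (the locating cut-off lives inside the plateau) then
`C·(O − Ō) = C·O·(1 − P) + C·O·[P, Δ₂]·Ō` — a gap piece and a commutator piece, nothing else.
[cite: Balaban1985BackgroundPropagators, p.415 l.29–31, (3.97) p.412, (3.88) p.409; Balaban1983RegularityDecay, Sect. 5 Thm (5.8) p.594 (statement type; derivation ours)] -/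
theorem cut_sub_eq_oneSided {O Ob Δ₁ Δ₂ P C : 𝓡} (h1 : O * Δ₁ = 1) (h2 : Δ₂ * Ob = 1) (hP : Δ₁ * P = Δ₂ * P) (hC : C * (1 - P) = 0) :
    C * (O - Ob) = C * O * (1 - P) + C * O * (P * Δ₂ - Δ₂ * P) * Ob := by
  calc C * (O - Ob) = C * (O * (1 - P) - (1 - P) * Ob + O * (P * Δ₂ - Δ₂ * P) * Ob) := by rw [sub_eq_comm_form h1 h2 hP]
    _ = C * O * (1 - P) - C * (1 - P) * Ob + C * O * (P * Δ₂ - Δ₂ * P) * Ob := by noncomm_ring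
    _ = _ := by rw [hC, zero_mul, sub_zero]

/-- ★ **THE RIGHT-LOCATED DIFFERENCE WITH GLOBAL ROWS**: if `(1 − P)·C = 0` then `(O − Ō)·C = (1 − P)·O·C + Ō·[Δ₂, P]·O·C`.
[cite: Balaban1985BackgroundPropagators, p.415 l.29–31, (3.97) p.412, (3.88) p.409; Balaban1983RegularityDecay, Sect. 5 Thm (5.8) p.594 (statement type; derivation ours)] -/
theorem sub_cut_eq_oneSided {O Ob Δ₁ Δ₂ P C : 𝓡} (h1 : Δ₁ * O = 1) (h2 : Ob * Δ₂ = 1) (hP : P * Δ₁ = P * Δ₂) (hC : (1 - P) * C = 0) :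
    (O - Ob) * C = (1 - P) * O * C + Ob * (Δ₂ * P - P * Δ₂) * O * C := by
  calc (O - Ob) * C = ((1 - P) * O - Ob * (1 - P) + Ob * (Δ₂ * P - P * Δ₂) * O) * C := by rw [sub_eq_comm_form' h1 h2 hP]
    _ = (1 - P) * O * C - Ob * ((1 - P) * C) + Ob * (Δ₂ * P - P * Δ₂) * O * C := by noncomm_ring
    _ = _ := by rw [hC, mul_zero, sub_zero]

end Ring

/-! ## §2  The difference letters through a site cut-off ((3.100) on the site carrier) -/

section Leibniz

variable (i : KIdx d ℓ hd hL b₀ b₁)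

/-- ★ **(3.100) FOR `∇_μ` THROUGH `M_χ`**: `∇_μ(χΛ)(z) = χ(z+e_μ)·(∇_μΛ)(z) + c·(χ(z+e_μ) − χ(z))·Λ(z)` — as operators on def-Y's site carrier,
`∇_μ ∘ M_χ = M_{χ(·+e_μ)} ∘ ∇_μ + (c·M_{χ(·+e_μ) − χ})`, `∇_μ = diffLetter (inl μ)` with constant `c` (`= η⁻¹` in the (3.49) entries).
[cite: Balaban1985BackgroundPropagators, (3.100) p.413 («(D_μ hA_ν)(x) = h(x)(D_μA_ν)(x) + (∂_μh)(x)R(U(x, x+ηe_μ))A_ν(x+ηe_μ)»), (3.3) p.390] -/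
theorem diffLetter_inl_mul_cutMulY (U : CfgY 𝔸 i) (c : ℂ) (μ : Fin (d + 1)) (χ : SiteY i → ℝ) :
    diffLetter (shiftY i) (UboxY i U) c (Sum.inl μ) * (cutMulY (𝔸 := 𝔸) χ).restrictScalars ℝ =
      (cutMulY (𝔸 := 𝔸) (fun z => χ (shiftY i μ z))).restrictScalars ℝ * diffLetter (shiftY i) (UboxY i U) c (Sum.inl μ) +
        (c • cutMulY (𝔸 := 𝔸) (fun z => χ (shiftY i μ z) - χ z)).restrictScalars ℝ := by
  refine LinearMap.ext fun Λ => funext fun z => ?_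
  simp only [Module.End.mul_apply, LinearMap.add_apply, LinearMap.restrictScalars_apply, LinearMap.smul_apply, Pi.add_apply, Pi.smul_apply,
    diffLetter_inl, gradLetterF_apply, B9Eq39Adjoint.covD, cutMulY_apply, R_smul]
  push_cast
  module

/-- ★ **(3.100) FOR `−∇*_ν` BEHIND `M_χ`** («similarly for adjoint derivatives»): `M_χ ∘ (−∇*_ν) = (−∇*_ν) ∘ M_{χ(·+e_ν)} + (c·M_{χ − χ(·+e_ν)})`,
`−∇*_ν = diffLetter (inr ν)`.
[cite: Balaban1985BackgroundPropagators, (3.100) p.413, (3.8) p.392] -/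
theorem cutMulY_mul_diffLetter_inr (U : CfgY 𝔸 i) (c : ℂ) (ν : Fin (d + 1)) (χ : SiteY i → ℝ) :
    (cutMulY (𝔸 := 𝔸) χ).restrictScalars ℝ * diffLetter (shiftY i) (UboxY i U) c (Sum.inr ν) =
      diffLetter (shiftY i) (UboxY i U) c (Sum.inr ν) * (cutMulY (𝔸 := 𝔸) (fun z => χ (shiftY i ν z))).restrictScalars ℝ +
        (c • cutMulY (𝔸 := 𝔸) (fun z => χ z - χ (shiftY i ν z))).restrictScalars ℝ := by
  refine LinearMap.ext fun Λ => funext fun z => ?_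
  simp only [Module.End.mul_apply, LinearMap.add_apply, LinearMap.restrictScalars_apply, LinearMap.smul_apply, Pi.add_apply, Pi.smul_apply,
    diffLetter_inr, LinearMap.neg_apply, Pi.neg_apply, gradLetterB_apply, B9Eq39Adjoint.covDstar, cutMulY_apply, R_smul, Equiv.apply_symm_apply]
  push_cast
  module

end Leibniz

/-! ## §3  The record's letters at the (3.35) datum -/

section Record

variable (i : KIdx d ℓ hd hL b₀ b₁) (c : ↥(cubes (toKT i).D.toDomains))

set_option maxHeartbeats 800000 in
/-- ★ **THE ROW FORM OF p21 D2's LAW**: `M_{χ_□}·Δ′_a(U^u) = M_{χ_□}·Δ′_{a,□}(Ṽ_□)` at the (3.35) datum (`parS := parSymY i`) — a row in `supp χ_□` lies in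
`D_χ`, where the member's and the cube's operators agree entry by entry (configuration agreement out to `3.5S_j + L^{j+1} ≤ 3.75S_j`, cube rows =
member rows on `NearH`).
[cite: Balaban1985BackgroundPropagators, (3.88) p.409, Cor. 3.6 p.408 («U′ = U^u = e^{iηA}»), p.409 l.1–5, p.410 l.14–15] -/
theorem cutMulY_chiY_mul_deltaPrimeAY_gauge (g : GaugeY 𝔸 i) (U : CfgY 𝔸 i) {Q : Set (Site (PV d ℓ i.m i.K hd hL) 0)} (η : ℝ) (A : AfldY 𝔸 i)
    (hQ : ∀ x : Site (PV d ℓ i.m i.K hd hL) 0, NearC i c (35 * SC i c / 8 + 1) (boxEquiv i.hN x).1 → x ∈ Q)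
    (hgA : ∀ (κ : Fin (d + 1)) (x : Site (PV d ℓ i.m i.K hd hL) 0), x ∈ Q → x.shift κ ∈ Q → gaugeY i g U κ x = fluct η A κ x) :
    cutMulY (𝔸 := 𝔸) (chiY i c) * deltaPrimeAY i (parSymY i) (gaugeY i g U) =
      cutMulY (𝔸 := 𝔸) (chiY i c) * deltaPrimeACubeY i c (parSymY i) (locCfgY i c η A) := by
  classical
  have h8 := eight_mul_bS_le_SC i c
  have hS := nine_le_SC i c
  have hagree := agreeNearY_locCfgY_of_nearC' i c η A hQ hgA (R := 7 * SC i c / 2 + (bS i c : ℤ)) (by omega) (by omega)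
    fun z hz => nearC_of_mem_Dchi i c hz
  refine LinearMap.ext fun Λ => funext fun z => ?_
  rw [Module.End.mul_apply, Module.End.mul_apply, cutMulY_apply, cutMulY_apply]
  by_cases hz : chiY i c z = 0
  · rw [hz, Complex.ofReal_zero, zero_smul, zero_smul]
  · have hD : z ∈ Dchi i c := mem_Dchi i c (self_mem_stencilY i z) hz
    rw [deltaPrimeAY_apply_congr_of_parLocalY (parLocalY_parSymY i) hagree _ hD,
      deltaPrimeACubeY_apply_eq_of_nearH i c (parSymY i) _ _ (nearH_of_mem_Dchi i c hD)]

omit [CompleteSpace 𝔸] in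
/-- `χl·χ_□ = χl ⟹ M_χl·(1 − M_{χ_□}) = 0` and `(1 − M_{χ_□})·M_χl = 0`. [cite: Balaban1985BackgroundPropagators, Cor. 3.6 p.408, bookkeeping] -/
theorem cutMulY_mul_one_sub_eq_zero (χl χ : SiteY i → ℝ) (h : ∀ z, χl z * χ z = χl z) :
    cutMulY (𝔸 := 𝔸) χl * (1 - cutMulY (𝔸 := 𝔸) χ) = 0 ∧ (1 - cutMulY (𝔸 := 𝔸) χ) * cutMulY (𝔸 := 𝔸) χl = 0 := by
  have e1 : cutMulY (𝔸 := 𝔸) χl * cutMulY (𝔸 := 𝔸) χ = cutMulY (𝔸 := 𝔸) χl := by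
    rw [cutMulY_mul]; exact congrArg cutMulY (funext h)
  have e2 : cutMulY (𝔸 := 𝔸) χ * cutMulY (𝔸 := 𝔸) χl = cutMulY (𝔸 := 𝔸) χl := by
    rw [cutMulY_mul]; exact congrArg cutMulY (funext fun z => by rw [mul_comm]; exact h z)
  constructor
  · rw [mul_sub, mul_one, e1, sub_self]
  · rw [sub_mul, one_mul, e2, sub_self]

set_option maxHeartbeats 800000 in
/-- ★★ **THE LEFT-LOCATED `G′`-DIFFERENCE OF FAMILY 3, EXACTLY**: at the (3.35) datum, for any site cut-off `χl` living inside the plateau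
(`χl·χ_□ = χl`), `M_χl·(G′(U^u) − G′_□(Ṽ_□)) = M_χl·G′(U^u)·(1 − M_{χ_□}) + M_χl·G′(U^u)·K(χ_□)(Ṽ_□)·G′_□(Ṽ_□)` — the gap piece (rows in `supp χl`,
columns off the plateau) and the commutator piece (through print's (3.89) letter, supported on `supp ∇χ_□`).  Inputs: `IsUnit Δ′_a(U^u)`,
`IsUnit Δ′_{a,□}(Ṽ_□)`, the datum's `hQ`∕`hgA` (p21 D2's row laws).
[cite: Balaban1985BackgroundPropagators, p.415 l.29–31, (3.97) p.412, (3.88)–(3.89) p.409, Cor. 3.6 p.408; Balaban1983RegularityDecay, Sect. 5 Thm (5.8) p.594 (statement type; derivation ours)] -/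
theorem cutMulY_GpY_sub_GpCubeY_eq (g : GaugeY 𝔸 i) (U : CfgY 𝔸 i) {Q : Set (Site (PV d ℓ i.m i.K hd hL) 0)} (η : ℝ) (A : AfldY 𝔸 i)
    (hQ : ∀ x : Site (PV d ℓ i.m i.K hd hL) 0, NearC i c (35 * SC i c / 8 + 1) (boxEquiv i.hN x).1 → x ∈ Q)
    (hgA : ∀ (κ : Fin (d + 1)) (x : Site (PV d ℓ i.m i.K hd hL) 0), x ∈ Q → x.shift κ ∈ Q → gaugeY i g U κ x = fluct η A κ x)
    (hW : IsUnit (deltaPrimeAY i (parSymY i) (gaugeY i g U))) (hV : IsUnit (deltaPrimeACubeY i c (parSymY i) (locCfgY i c η A)))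
    (χl : SiteY i → ℝ) (hχl : ∀ z, χl z * chiY i c z = χl z) :
    cutMulY (𝔸 := 𝔸) χl * (GpY i (parSymY i) (gaugeY i g U) - GpCubeY i c (parSymY i) (locCfgY i c η A)) =
      cutMulY (𝔸 := 𝔸) χl * GpY i (parSymY i) (gaugeY i g U) * (1 - cutMulY (𝔸 := 𝔸) (chiY i c)) +
        cutMulY (𝔸 := 𝔸) χl * GpY i (parSymY i) (gaugeY i g U) * KhY i (parSymY i) (chiY i c) (locCfgY i c η A) *
          GpCubeY i c (parSymY i) (locCfgY i c η A) := by
  rw [← comm_cutMulY_chiY_deltaPrimeACubeY i c (locCfgY i c η A)]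
  exact cut_sub_eq_oneSided (GpY_mul_deltaPrimeAY i (parSymY i) _ hW) (deltaPrimeACubeY_mul_GpCubeY i c (parSymY i) _ hV)
    (deltaPrimeAY_gauge_mul_cutMulY_chiY i c g U η A hQ hgA) (cutMulY_mul_one_sub_eq_zero i χl (chiY i c) hχl).1

set_option maxHeartbeats 800000 in
/-- ★★ **THE RIGHT-LOCATED `G′`-DIFFERENCE OF FAMILY 3, EXACTLY**: `(G′(U^u) − G′_□(Ṽ_□))·M_χl = (1 − M_{χ_□})·G′(U^u)·M_χl +
G′_□(Ṽ_□)·(Δ′_{a,□}M_{χ_□} − M_{χ_□}Δ′_{a,□})(Ṽ_□)·G′(U^u)·M_χl`, the middle letter being `−K(χ_□)(Ṽ_□)`.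
[cite: Balaban1985BackgroundPropagators, p.415 l.29–31, (3.97) p.412, (3.88)–(3.89) p.409, Cor. 3.6 p.408; Balaban1983RegularityDecay, Sect. 5 Thm (5.8) p.594 (statement type; derivation ours)] -/
theorem GpY_sub_GpCubeY_cutMulY_eq (g : GaugeY 𝔸 i) (U : CfgY 𝔸 i) {Q : Set (Site (PV d ℓ i.m i.K hd hL) 0)} (η : ℝ) (A : AfldY 𝔸 i)
    (hQ : ∀ x : Site (PV d ℓ i.m i.K hd hL) 0, NearC i c (35 * SC i c / 8 + 1) (boxEquiv i.hN x).1 → x ∈ Q)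
    (hgA : ∀ (κ : Fin (d + 1)) (x : Site (PV d ℓ i.m i.K hd hL) 0), x ∈ Q → x.shift κ ∈ Q → gaugeY i g U κ x = fluct η A κ x)
    (hW : IsUnit (deltaPrimeAY i (parSymY i) (gaugeY i g U))) (hV : IsUnit (deltaPrimeACubeY i c (parSymY i) (locCfgY i c η A)))
    (χl : SiteY i → ℝ) (hχl : ∀ z, χl z * chiY i c z = χl z) :
    (GpY i (parSymY i) (gaugeY i g U) - GpCubeY i c (parSymY i) (locCfgY i c η A)) * cutMulY (𝔸 := 𝔸) χl =
      (1 - cutMulY (𝔸 := 𝔸) (chiY i c)) * GpY i (parSymY i) (gaugeY i g U) * cutMulY (𝔸 := 𝔸) χl +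
        GpCubeY i c (parSymY i) (locCfgY i c η A) * (-KhY i (parSymY i) (chiY i c) (locCfgY i c η A)) *
          GpY i (parSymY i) (gaugeY i g U) * cutMulY (𝔸 := 𝔸) χl := by
  have hK : deltaPrimeACubeY i c (parSymY i) (locCfgY i c η A) * cutMulY (𝔸 := 𝔸) (chiY i c) -
      cutMulY (𝔸 := 𝔸) (chiY i c) * deltaPrimeACubeY i c (parSymY i) (locCfgY i c η A) = -KhY i (parSymY i) (chiY i c) (locCfgY i c η A) := by
    rw [← comm_cutMulY_chiY_deltaPrimeACubeY i c (locCfgY i c η A), neg_sub]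
  rw [← hK]
  exact sub_cut_eq_oneSided (deltaPrimeAY_mul_GpY i (parSymY i) _ hW) (GpCubeY_mul_deltaPrimeACubeY i c (parSymY i) _ hV)
    (cutMulY_chiY_mul_deltaPrimeAY_gauge i c g U η A hQ hgA) (cutMulY_mul_one_sub_eq_zero i χl (chiY i c) hχl).2

end Record

/-! ## §4  The same at the consumer's pair `(U₁, Ṽ_□^{u⁻¹})` (F3-B∕F3-P read the difference at `cfg U₁` and `V′_□ = gaugeY (u □)⁻¹ Ṽ_□`) -/

section AtPair

variable (i : KIdx d ℓ hd hL b₀ b₁) (c : ↥(cubes (toKT i).D.toDomains))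

/-- (3.31)–(3.32) for the cube operator at the gauged-back field: `Δ′_{a,□}(Ṽ^{g⁻¹}) = R(g)⁻¹·Δ′_{a,□}(Ṽ)·R(g)`.
[cite: Balaban1985BackgroundPropagators, (3.31)–(3.32) p.395, p.409 l.3–5] -/
theorem deltaPrimeACubeY_gauge_inv_eq {parS : SiteParY 𝔸 i} (hS : IsGaugeLawS i parS) (g : GaugeY 𝔸 i) (V : CfgY 𝔸 i) :
    deltaPrimeACubeY i c parS (gaugeY i g⁻¹ V) = conjY (gSiteY i g)⁻¹ * deltaPrimeACubeY i c parS V * conjY (gSiteY i g) := by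
  have h : deltaPrimeACubeY i c parS (gaugeY i g⁻¹ V) * conjY (gSiteY i g)⁻¹ = conjY (gSiteY i g)⁻¹ * deltaPrimeACubeY i c parS V :=
    deltaPrimeACubeY_cov c g⁻¹ V hS
  rw [← h, mul_assoc, conjY_inv_mul_conjY, mul_one]

/-- ★ p21 D2's COLUMN LAW at the pair `(U, Ṽ_□^{g⁻¹})`: `Δ′_a(U)·M_{χ_□} = Δ′_{a,□}(Ṽ_□^{g⁻¹})·M_{χ_□}` (both sides are the `R(g)`-conjugates of the law at
`(U^g, Ṽ_□)`, and `M_{χ_□}` commutes with `R(g)`). [cite: Balaban1985BackgroundPropagators, (3.88) p.409, (3.31)–(3.33) pp.395–396, Cor. 3.6 p.408] -/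
theorem deltaPrimeAY_mul_cutMulY_chiY_at (g : GaugeY 𝔸 i) (U : CfgY 𝔸 i) {Q : Set (Site (PV d ℓ i.m i.K hd hL) 0)} (η : ℝ) (A : AfldY 𝔸 i)
    (hQ : ∀ x : Site (PV d ℓ i.m i.K hd hL) 0, NearC i c (35 * SC i c / 8 + 1) (boxEquiv i.hN x).1 → x ∈ Q)
    (hgA : ∀ (κ : Fin (d + 1)) (x : Site (PV d ℓ i.m i.K hd hL) 0), x ∈ Q → x.shift κ ∈ Q → gaugeY i g U κ x = fluct η A κ x) :
    deltaPrimeAY i (parSymY i) U * cutMulY (𝔸 := 𝔸) (chiY i c) =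
      deltaPrimeACubeY i c (parSymY i) (gaugeY i g⁻¹ (locCfgY i c η A)) * cutMulY (𝔸 := 𝔸) (chiY i c) := by
  rw [deltaPrimeAY_eq_conj i (parSymY_isGaugeLawS i) g U, deltaPrimeACubeY_gauge_inv_eq i c (parSymY_isGaugeLawS i)]
  set Γ : Module.End ℂ (SiteY i → 𝔸) := conjY (gSiteY i g)
  set Γi : Module.End ℂ (SiteY i → 𝔸) := conjY (gSiteY i g)⁻¹
  set C : Module.End ℂ (SiteY i → 𝔸) := cutMulY (𝔸 := 𝔸) (chiY i c)
  have e : C * Γ = Γ * C := cutMulY_mul_conjY i _ _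
  have law := deltaPrimeAY_gauge_mul_cutMulY_chiY i c g U η A hQ hgA
  calc Γi * deltaPrimeAY i (parSymY i) (gaugeY i g U) * Γ * C = Γi * (deltaPrimeAY i (parSymY i) (gaugeY i g U) * C) * Γ := by
        rw [mul_assoc (Γi * _) Γ C, ← e]; noncomm_ring
    _ = Γi * (deltaPrimeACubeY i c (parSymY i) (locCfgY i c η A) * C) * Γ := by rw [law]
    _ = _ := by rw [mul_assoc Γi, mul_assoc _ C Γ, e]; noncomm_ring

/-- ★ the ROW LAW at the pair `(U, Ṽ_□^{g⁻¹})`: `M_{χ_□}·Δ′_a(U) = M_{χ_□}·Δ′_{a,□}(Ṽ_□^{g⁻¹})`. [cite: Balaban1985BackgroundPropagators, (3.88) p.409, (3.31)–(3.33) pp.395–396, Cor. 3.6 p.408] -/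
theorem cutMulY_chiY_mul_deltaPrimeAY_at (g : GaugeY 𝔸 i) (U : CfgY 𝔸 i) {Q : Set (Site (PV d ℓ i.m i.K hd hL) 0)} (η : ℝ) (A : AfldY 𝔸 i)
    (hQ : ∀ x : Site (PV d ℓ i.m i.K hd hL) 0, NearC i c (35 * SC i c / 8 + 1) (boxEquiv i.hN x).1 → x ∈ Q)
    (hgA : ∀ (κ : Fin (d + 1)) (x : Site (PV d ℓ i.m i.K hd hL) 0), x ∈ Q → x.shift κ ∈ Q → gaugeY i g U κ x = fluct η A κ x) :
    cutMulY (𝔸 := 𝔸) (chiY i c) * deltaPrimeAY i (parSymY i) U =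
      cutMulY (𝔸 := 𝔸) (chiY i c) * deltaPrimeACubeY i c (parSymY i) (gaugeY i g⁻¹ (locCfgY i c η A)) := by
  rw [deltaPrimeAY_eq_conj i (parSymY_isGaugeLawS i) g U, deltaPrimeACubeY_gauge_inv_eq i c (parSymY_isGaugeLawS i)]
  set Γ : Module.End ℂ (SiteY i → 𝔸) := conjY (gSiteY i g)
  set Γi : Module.End ℂ (SiteY i → 𝔸) := conjY (gSiteY i g)⁻¹
  set C : Module.End ℂ (SiteY i → 𝔸) := cutMulY (𝔸 := 𝔸) (chiY i c)
  have e : C * Γi = Γi * C := cutMulY_mul_conjY i _ _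
  have law := cutMulY_chiY_mul_deltaPrimeAY_gauge i c g U η A hQ hgA
  calc C * (Γi * deltaPrimeAY i (parSymY i) (gaugeY i g U) * Γ) = Γi * (C * deltaPrimeAY i (parSymY i) (gaugeY i g U)) * Γ := by
        rw [← mul_assoc, ← mul_assoc, e]; noncomm_ring
    _ = Γi * (C * deltaPrimeACubeY i c (parSymY i) (locCfgY i c η A)) * Γ := by rw [law]
    _ = _ := by rw [← mul_assoc Γi C, ← e]; noncomm_ring

set_option maxHeartbeats 800000 in
/-- ★★ **THE LEFT-LOCATED `G′`-DIFFERENCE AT THE CONSUMER's PAIR**: `M_χl·(G′(U) − G′_□(Ṽ_□^{g⁻¹})) = M_χl·G′(U)·(1 − M_{χ_□}) +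
M_χl·G′(U)·K(χ_□)(Ṽ_□^{g⁻¹})·G′_□(Ṽ_□^{g⁻¹})` — F3-B's `hDL` difference (`Gp (cfg U₁) − GpCubeY □ parSymY V′_□`), exactly.
[cite: Balaban1985BackgroundPropagators, p.415 l.29–31, (3.97) p.412, (3.88)–(3.89) p.409, (3.33) p.396, Cor. 3.6 p.408; Balaban1983RegularityDecay, Sect. 5 Thm (5.8) p.594 (statement type; derivation ours)] -/
theorem cutMulY_GpY_sub_GpCubeY_eq_at (g : GaugeY 𝔸 i) (U : CfgY 𝔸 i) {Q : Set (Site (PV d ℓ i.m i.K hd hL) 0)} (η : ℝ) (A : AfldY 𝔸 i)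
    (hQ : ∀ x : Site (PV d ℓ i.m i.K hd hL) 0, NearC i c (35 * SC i c / 8 + 1) (boxEquiv i.hN x).1 → x ∈ Q)
    (hgA : ∀ (κ : Fin (d + 1)) (x : Site (PV d ℓ i.m i.K hd hL) 0), x ∈ Q → x.shift κ ∈ Q → gaugeY i g U κ x = fluct η A κ x)
    (hU : IsUnit (deltaPrimeAY i (parSymY i) U)) (hV : IsUnit (deltaPrimeACubeY i c (parSymY i) (gaugeY i g⁻¹ (locCfgY i c η A))))
    (χl : SiteY i → ℝ) (hχl : ∀ z, χl z * chiY i c z = χl z) :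
    cutMulY (𝔸 := 𝔸) χl * (GpY i (parSymY i) U - GpCubeY i c (parSymY i) (gaugeY i g⁻¹ (locCfgY i c η A))) =
      cutMulY (𝔸 := 𝔸) χl * GpY i (parSymY i) U * (1 - cutMulY (𝔸 := 𝔸) (chiY i c)) +
        cutMulY (𝔸 := 𝔸) χl * GpY i (parSymY i) U * KhY i (parSymY i) (chiY i c) (gaugeY i g⁻¹ (locCfgY i c η A)) *
          GpCubeY i c (parSymY i) (gaugeY i g⁻¹ (locCfgY i c η A)) := by
  rw [← comm_cutMulY_chiY_deltaPrimeACubeY i c (gaugeY i g⁻¹ (locCfgY i c η A))]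
  exact cut_sub_eq_oneSided (GpY_mul_deltaPrimeAY i (parSymY i) _ hU) (deltaPrimeACubeY_mul_GpCubeY i c (parSymY i) _ hV)
    (deltaPrimeAY_mul_cutMulY_chiY_at i c g U η A hQ hgA) (cutMulY_mul_one_sub_eq_zero i χl (chiY i c) hχl).1

set_option maxHeartbeats 800000 in
/-- ★★ **THE RIGHT-LOCATED `G′`-DIFFERENCE AT THE CONSUMER's PAIR**: `(G′(U) − G′_□(Ṽ′))·M_χl = (1 − M_{χ_□})·G′(U)·M_χl + G′_□(Ṽ′)·(−K(χ_□)(Ṽ′))·G′(U)·M_χl`,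
`Ṽ′ = Ṽ_□^{g⁻¹}` — F3-B's `hDR` difference, exactly.
[cite: Balaban1985BackgroundPropagators, p.415 l.29–31, (3.97) p.412, (3.88)–(3.89) p.409, (3.33) p.396, Cor. 3.6 p.408; Balaban1983RegularityDecay, Sect. 5 Thm (5.8) p.594 (statement type; derivation ours)] -/
theorem GpY_sub_GpCubeY_cutMulY_eq_at (g : GaugeY 𝔸 i) (U : CfgY 𝔸 i) {Q : Set (Site (PV d ℓ i.m i.K hd hL) 0)} (η : ℝ) (A : AfldY 𝔸 i)
    (hQ : ∀ x : Site (PV d ℓ i.m i.K hd hL) 0, NearC i c (35 * SC i c / 8 + 1) (boxEquiv i.hN x).1 → x ∈ Q)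
    (hgA : ∀ (κ : Fin (d + 1)) (x : Site (PV d ℓ i.m i.K hd hL) 0), x ∈ Q → x.shift κ ∈ Q → gaugeY i g U κ x = fluct η A κ x)
    (hU : IsUnit (deltaPrimeAY i (parSymY i) U)) (hV : IsUnit (deltaPrimeACubeY i c (parSymY i) (gaugeY i g⁻¹ (locCfgY i c η A))))
    (χl : SiteY i → ℝ) (hχl : ∀ z, χl z * chiY i c z = χl z) :
    (GpY i (parSymY i) U - GpCubeY i c (parSymY i) (gaugeY i g⁻¹ (locCfgY i c η A))) * cutMulY (𝔸 := 𝔸) χl =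
      (1 - cutMulY (𝔸 := 𝔸) (chiY i c)) * GpY i (parSymY i) U * cutMulY (𝔸 := 𝔸) χl +
        GpCubeY i c (parSymY i) (gaugeY i g⁻¹ (locCfgY i c η A)) * (-KhY i (parSymY i) (chiY i c) (gaugeY i g⁻¹ (locCfgY i c η A))) *
          GpY i (parSymY i) U * cutMulY (𝔸 := 𝔸) χl := by
  have hK : deltaPrimeACubeY i c (parSymY i) (gaugeY i g⁻¹ (locCfgY i c η A)) * cutMulY (𝔸 := 𝔸) (chiY i c) -
      cutMulY (𝔸 := 𝔸) (chiY i c) * deltaPrimeACubeY i c (parSymY i) (gaugeY i g⁻¹ (locCfgY i c η A)) =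
      -KhY i (parSymY i) (chiY i c) (gaugeY i g⁻¹ (locCfgY i c η A)) := by
    rw [← comm_cutMulY_chiY_deltaPrimeACubeY i c (gaugeY i g⁻¹ (locCfgY i c η A)), neg_sub]
  rw [← hK]
  exact sub_cut_eq_oneSided (deltaPrimeAY_mul_GpY i (parSymY i) _ hU) (GpCubeY_mul_deltaPrimeACubeY i c (parSymY i) _ hV)
    (cutMulY_chiY_mul_deltaPrimeAY_at i c g U η A hQ hgA) (cutMulY_mul_one_sub_eq_zero i χl (chiY i c) hχl).2

end AtPair

end Literature.MathematicalPhysics.QuantumFieldTheory.Balaban1983to89.B9Eq3105FamThreeLocDiffG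

end
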